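import Summits.HubbardSuperconductivity.HubbardSuperconductivity.Theorems.JosephsonMirrorFreeLayersPairBounds
import Literature.MathematicalPhysics.QuantumLattice.TorusShellCountUniform

/-!
# Route `JosephsonMirror` — a free layer gains only `o(J)·L²` from a reduced BCS interaction

Helper file for support item stmt-HubbardSuperconductivity-2232 (`JmFreeLayersNoCusp`) of route
`JosephsonMirror` (sub-problem `HubbardSuperconductivity`): the grand-canonical core estimate of the
`U = 0` calibration. For the free torus layer `H(1,0) - μN = Σ_k ξ_k (n_{k↑} + n_{-k↓})` (`L ≥ 3`)
and the scaled `d`-wave pair field `D = L⁻¹ Δ_d = -(2√2/L) B`, `B = Σ_k ĝ_d(k) b_k`, we prove for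
every shell half-width `Λ > 0` and coupling `0 ≤ J ≤ Λ/96`, as quadratic forms on the whole Fock
space:

  `H(1,0) - μN - J D Dᴴ ≥ Σ_k 2 min(ξ_k, 0) - 96 J - 96 J s²/L²`   (`re_expect_free_sub_pairing_ge`),
  `H(1,0) - μN - J Dᴴ D ≥ Σ_k 2 min(ξ_k, 0) - 128 J - 96 J s²/L²`  (`re_expect_free_sub_pairing_ge'`),

`s = #{k : -Λ < ξ_k < Λ}` (which is `≤ √Λ L² + 2L` uniformly in `μ`, `TorusShellCountUniform`). The
right side is the Fermi-sea energy minus an error that is LINEAR in `J` with a coefficient that is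
small when the shell is thin — all the item needs (`o(J)`, not the BCS `e^{-c/J}`; no Bogoliubov /
approximating-Hamiltonian argument). Mechanism: split `B = B_out + B_in + B_sh`; outside the sea
normal-order (commutator sum) and bound `‖B_out w‖²` by weighted Cauchy–Schwarz with weights `ξ_k`,
absorbed by the particle energy when `J ≲ Λ`; inside, `‖B_in† w‖²` with weights `|ξ_k|` against the
hole energy; on the shell the coherent bound `4 s² ‖w‖²` (`JosephsonMirrorFreeLayersPairBounds`).
Sources: J. Bardeen, L. N. Cooper, J. R. Schrieffer, Phys. Rev. 108 (1957) 1175, §II; J. von Delft,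
D. C. Ralph, Phys. Rep. 345 (2001) 61, §4.2.3. Folklore finite-dimensional statements; no new
definitions.
-/

-- the mandated namespace `Summit.<Summit>.<Problem>.Theorems` repeats `HubbardSuperconductivity`
-- (single-problem summit, D-0017), which the `dupNamespace` linter flags on every declaration
set_option linter.dupNamespace false

namespace Summit.HubbardSuperconductivity.HubbardSuperconductivity.Theorems.JosephsonMirror

open Matrix Finset Literature.MathematicalPhysics.QuantumLattice Literature.Probability.LatticeModels
open scoped ComplexOrder ComplexConjugate

/-! ### The free layer with a reduced BCS interaction: grand-canonical lower bound -/

section GCBound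

variable {L : ℕ} [NeZero L]

omit [NeZero L] in
/-- `ĝ_d(k)² ≤ 4` for the `d_{x²-y²}` form factor `cos k₁ - cos k₂`. [folklore] -/
theorem dWaveGap_sq_le_four (k : TorusSite 2 L) : dWaveGap k ^ 2 ≤ 4 := by
  unfold dWaveGap
  have h1 := Real.abs_cos_le_one (latticeMomentum L k 0)
  have h2 := Real.abs_cos_le_one (latticeMomentum L k 1)
  rw [abs_le] at h1 h2
  nlinarith [h1.1, h1.2, h2.1, h2.2]

omit [NeZero L] in
/-- `|ĝ_d(k)| ≤ 2`. [folklore] -/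
theorem abs_dWaveGap_le_two_jm (k : TorusSite 2 L) : |dWaveGap k| ≤ 2 := by
  have h := dWaveGap_sq_le_four k
  rw [← sq_abs] at h
  nlinarith [abs_nonneg (dWaveGap k)]

/-- Splitting a sum over all momenta into three regions cut out by two predicates
(`p`; `¬p ∧ q`; `¬p ∧ ¬q`). [folklore] -/
theorem sum_univ_eq_sum_filter_add_three {M : Type*} [AddCommMonoid M] (p q : TorusSite 2 L → Prop)
    [DecidablePred p] [DecidablePred q] (f : TorusSite 2 L → M) :
    ∑ k, f k = ∑ k ∈ univ.filter p, f k + ∑ k ∈ univ.filter (fun k => ¬ p k ∧ q k), f k +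
      ∑ k ∈ univ.filter (fun k => ¬ p k ∧ ¬ q k), f k := by
  rw [← Finset.sum_filter_add_sum_filter_not univ p,
    ← Finset.sum_filter_add_sum_filter_not (univ.filter fun k => ¬ p k) q, Finset.filter_filter,
    Finset.filter_filter, add_assoc]

/-- The pair operator over all momenta splits over the three regions. [folklore] -/
theorem pairOperator_univ_eq_add_three (ĝ : TorusSite 2 L → ℝ) (p q : TorusSite 2 L → Prop)
    [DecidablePred p] [DecidablePred q] :
    pairOperator ĝ univ = pairOperator ĝ (univ.filter p) +
      pairOperator ĝ (univ.filter fun k => ¬ p k ∧ q k) +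
        pairOperator ĝ (univ.filter fun k => ¬ p k ∧ ¬ q k) := by
  simp only [pairOperator]
  exact sum_univ_eq_sum_filter_add_three p q _

/-- The kinetic energy of the free layer as a sum over pair blocks:
`Re ⟨w, (H(1,0) - μN) w⟩ = Σ_k ξ_k (Re ⟨w, n_{k↑} w⟩ + Re ⟨w, n_{-k↓} w⟩)` (`L ≥ 3`). [folklore] -/
theorem re_expect_hubbardTorusWith_zero (hL : 3 ≤ L) (μ : ℝ) (w : Fock (Orb (FermionTorus 2 L))) :
    (star w ⬝ᵥ hubbardTorusWith 2 L 1 0 μ *ᵥ w).re =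
      ∑ k : TorusSite 2 L, (torusBand L k - μ) *
        ((star w ⬝ᵥ momentumNumber k 0 *ᵥ w).re + (star w ⬝ᵥ momentumNumber (-k) 1 *ᵥ w).re) := by
  rw [hubbardTorusWith_zero_eq_sum_pairBlock_kinetic hL μ, sum_mulVec, dotProduct_sum, Complex.re_sum]
  refine Finset.sum_congr rfl fun k _ => ?_
  rw [smul_mulVec, dotProduct_smul, smul_eq_mul, Complex.re_ofReal_mul, add_mulVec, dotProduct_add,
    Complex.add_re]

/-- **Kinetic-energy budget** (real bookkeeping). For occupations `α_k, β_k ∈ [0, n]` and levels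
`ξ_k`, with `Out ⊆ {ξ ≥ 0}` and `In ⊆ {ξ ≤ 0}` disjoint:
`(Σ_k 2 min(ξ_k, 0)) n + Σ_{Out} ξ_k α_k + Σ_{In} (-ξ_k)(n - β_k) ≤ Σ_k ξ_k (α_k + β_k)` —
the Fermi-sea energy plus the particle energy above and the hole energy below. [folklore] -/
theorem sum_budget (Out In : Finset (TorusSite 2 L)) (hdisj : Disjoint Out In)
    (ξ α β : TorusSite 2 L → ℝ) (n : ℝ)
    (hα0 : ∀ k, 0 ≤ α k) (hαn : ∀ k, α k ≤ n) (hβ0 : ∀ k, 0 ≤ β k) (hβn : ∀ k, β k ≤ n)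
    (hOut : ∀ k ∈ Out, 0 ≤ ξ k) (hIn : ∀ k ∈ In, ξ k ≤ 0) :
    (∑ k, 2 * min (ξ k) 0) * n + ∑ k ∈ Out, ξ k * α k + ∑ k ∈ In, (-ξ k) * (n - β k) ≤
      ∑ k, ξ k * (α k + β k) := by
  -- the excess over the Fermi sea, mode by mode
  have hE0 : ∀ k, 0 ≤ ξ k * (α k + β k) - 2 * min (ξ k) 0 * n := by
    intro k
    rcases le_or_gt 0 (ξ k) with h | h
    · rw [min_eq_right h]
      nlinarith [mul_nonneg h (hα0 k), mul_nonneg h (hβ0 k)]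
    · rw [min_eq_left h.le]
      nlinarith [mul_nonneg_of_nonpos_of_nonpos h.le (by linarith [hαn k] : α k - n ≤ 0),
        mul_nonneg_of_nonpos_of_nonpos h.le (by linarith [hβn k] : β k - n ≤ 0)]
  have hEout : ∀ k ∈ Out, ξ k * α k ≤ ξ k * (α k + β k) - 2 * min (ξ k) 0 * n := by
    intro k hk
    rw [min_eq_right (hOut k hk)]
    nlinarith [mul_nonneg (hOut k hk) (hβ0 k)]
  have hEin : ∀ k ∈ In, (-ξ k) * (n - β k) ≤ ξ k * (α k + β k) - 2 * min (ξ k) 0 * n := by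
    intro k hk
    rw [min_eq_left (hIn k hk)]
    nlinarith [mul_nonneg_of_nonpos_of_nonpos (hIn k hk) (by linarith [hαn k] : α k - n ≤ 0)]
  have hsum : ∑ k, (ξ k * (α k + β k) - 2 * min (ξ k) 0 * n) =
      ∑ k, ξ k * (α k + β k) - (∑ k, 2 * min (ξ k) 0) * n := by
    rw [Finset.sum_sub_distrib, Finset.sum_mul]
  have hsub : ∑ k ∈ Out ∪ In, (ξ k * (α k + β k) - 2 * min (ξ k) 0 * n) ≤
      ∑ k, (ξ k * (α k + β k) - 2 * min (ξ k) 0 * n) :=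
    Finset.sum_le_sum_of_subset_of_nonneg (Finset.subset_univ _) fun k _ _ => hE0 k
  rw [Finset.sum_union hdisj] at hsub
  have h1 : ∑ k ∈ Out, ξ k * α k ≤ ∑ k ∈ Out, (ξ k * (α k + β k) - 2 * min (ξ k) 0 * n) :=
    Finset.sum_le_sum hEout
  have h2 : ∑ k ∈ In, (-ξ k) * (n - β k) ≤
      ∑ k ∈ In, (ξ k * (α k + β k) - 2 * min (ξ k) 0 * n) :=
    Finset.sum_le_sum hEin
  linarith

/-- `D Dᴴ = (8/L²) B Bᴴ` and `Dᴴ D = (8/L²) Bᴴ B` for `D = L⁻¹ Δ_d`, `Δ_d = -2√2 B`,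
`B = B(ĝ_d, all k)` (`pairField_dWave_eq_smul_pairOperator`). [folklore] -/
theorem pairField_scaled_mul_conjTranspose :
    ((((L : ℂ))⁻¹ • pairField dWaveFormFactor L) * (((L : ℂ))⁻¹ • pairField dWaveFormFactor L)ᴴ =
      ((8 / (L : ℝ) ^ 2 : ℝ) : ℂ) • (pairOperator dWaveGap (univ : Finset (TorusSite 2 L)) *
        (pairOperator dWaveGap (univ : Finset (TorusSite 2 L)))ᴴ)) ∧
    ((((L : ℂ))⁻¹ • pairField dWaveFormFactor L)ᴴ * (((L : ℂ))⁻¹ • pairField dWaveFormFactor L) =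
      ((8 / (L : ℝ) ^ 2 : ℝ) : ℂ) • ((pairOperator dWaveGap (univ : Finset (TorusSite 2 L)))ᴴ *
        pairOperator dWaveGap (univ : Finset (TorusSite 2 L)))) := by
  set r : ℝ := -(2 * Real.sqrt 2 / L) with hr
  have hD : ((L : ℂ))⁻¹ • pairField dWaveFormFactor L =
      (r : ℂ) • pairOperator dWaveGap (univ : Finset (TorusSite 2 L)) := by
    rw [pairField_dWave_eq_smul_pairOperator, smul_neg, smul_smul, ← neg_smul, hr]
    congr 1
    push_cast
    ring
  have hrr : ((r * r : ℝ) : ℂ) = ((8 / (L : ℝ) ^ 2 : ℝ) : ℂ) := by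
    congr 1
    rw [hr, neg_mul_neg, div_mul_div_comm, mul_mul_mul_comm, Real.mul_self_sqrt (by norm_num)]
    ring
  have hstar : star (r : ℂ) = (r : ℂ) := Complex.conj_ofReal r
  refine ⟨?_, ?_⟩
  · rw [hD, conjTranspose_smul, hstar, smul_mul_smul_comm, ← Complex.ofReal_mul, hrr]
  · rw [hD, conjTranspose_smul, hstar, smul_mul_smul_comm, ← Complex.ofReal_mul, hrr]

/-- **The free layer does not gain from the reduced BCS interaction, `B Bᴴ` ordering.** For
`L ≥ 3`, any `μ`, a shell half-width `Λ > 0` and a coupling `0 ≤ J ≤ Λ/96`: for every Fock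
vector `w`,
`Re ⟨w, (H(1,0) - μN - J D Dᴴ) w⟩ ≥ (Σ_k 2min(ξ_k,0) - 96J - 96J s²/L²) ‖w‖²`,
`D = L⁻¹Δ_d`, `s = #{k : |ξ_k| < Λ}` (written as the complement of `{ξ ≥ Λ} ∪ {ξ ≤ -Λ}`). Proof:
split `B = B_out + B_in + B_sh`, `‖Bᴴw‖² ≤ 3 Σ ‖B_•ᴴ w‖²`; outside, normal-order (commutator sum)
and use weighted Cauchy–Schwarz against the particle energy; inside, weighted Cauchy–Schwarz
against the hole energy; on the shell the crude bound `4s²‖w‖²`. BCS (1957) §II (kinetic cost of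
pair fluctuations); von Delft–Ralph (2001) §4.2.3. [folklore] -/
theorem re_expect_free_sub_pairing_ge (hL : 3 ≤ L) (μ : ℝ) {Λ J : ℝ} (hΛ : 0 < Λ) (hJ : 0 ≤ J)
    (hJΛ : 96 * J ≤ Λ) (w : Fock (Orb (FermionTorus 2 L))) :
    (∑ k : TorusSite 2 L, 2 * min (torusBand L k - μ) 0 - (96 * J + 96 * J *
      (((univ.filter fun k : TorusSite 2 L => ¬ (Λ ≤ torusBand L k - μ) ∧
        ¬ (torusBand L k - μ ≤ -Λ)).card : ℝ) ^ 2 / (L : ℝ) ^ 2))) * (star w ⬝ᵥ w).re ≤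
      (star w ⬝ᵥ (hubbardTorusWith 2 L 1 0 μ -
        (J : ℂ) • ((((L : ℂ))⁻¹ • pairField dWaveFormFactor L) *
          (((L : ℂ))⁻¹ • pairField dWaveFormFactor L)ᴴ)) *ᵥ w).re := by
  -- regions
  set Out : Finset (TorusSite 2 L) := univ.filter fun k => Λ ≤ torusBand L k - μ with hOut
  set In : Finset (TorusSite 2 L) :=
    univ.filter fun k => ¬ (Λ ≤ torusBand L k - μ) ∧ torusBand L k - μ ≤ -Λ with hIn
  set Sh : Finset (TorusSite 2 L) :=
    univ.filter fun k => ¬ (Λ ≤ torusBand L k - μ) ∧ ¬ (torusBand L k - μ ≤ -Λ) with hSh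
  obtain ⟨B, hB⟩ : ∃ B, B = pairOperator dWaveGap (univ : Finset (TorusSite 2 L)) := ⟨_, rfl⟩
  obtain ⟨c₂, hc₂⟩ : ∃ c₂ : ℝ, c₂ = (Sh.card : ℝ) ^ 2 / (L : ℝ) ^ 2 := ⟨_, rfl⟩
  set n : ℝ := (star w ⬝ᵥ w).re with hn
  have hĝ : ∀ k : TorusSite 2 L, |dWaveGap k| ≤ 2 := abs_dWaveGap_le_two_jm
  have hn0 : 0 ≤ n := re_star_dotProduct_self_nonneg' w
  have hα0 : ∀ k : TorusSite 2 L, 0 ≤ (star w ⬝ᵥ momentumNumber k 0 *ᵥ w).re := fun k =>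
    re_expect_momentumNumber_nonneg k 0 w
  have hαn : ∀ k : TorusSite 2 L, (star w ⬝ᵥ momentumNumber k 0 *ᵥ w).re ≤ n := fun k =>
    re_expect_momentumNumber_le k 0 w
  have hβ0 : ∀ k : TorusSite 2 L, 0 ≤ (star w ⬝ᵥ momentumNumber (-k) 1 *ᵥ w).re := fun k =>
    re_expect_momentumNumber_nonneg (-k) 1 w
  have hβn : ∀ k : TorusSite 2 L, (star w ⬝ᵥ momentumNumber (-k) 1 *ᵥ w).re ≤ n := fun k =>
    re_expect_momentumNumber_le (-k) 1 w
  have hL0 : (0 : ℝ) < L := by exact_mod_cast (show 0 < L by omega)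
  have hL2 : (0 : ℝ) < (L : ℝ) ^ 2 := by positivity
  have hcardL : ∀ S : Finset (TorusSite 2 L), (S.card : ℝ) ≤ (L : ℝ) ^ 2 := by
    intro S
    have h := S.card_le_univ
    rw [card_torusSite_two] at h
    exact_mod_cast h
  -- the two kinetic integrals
  obtain ⟨O, hO⟩ : ∃ O : ℝ, O = ∑ k ∈ Out, (torusBand L k - μ) *
    (star w ⬝ᵥ momentumNumber k 0 *ᵥ w).re := ⟨_, rfl⟩
  obtain ⟨I, hI⟩ : ∃ I : ℝ, I = ∑ k ∈ In, (μ - torusBand L k) *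
    (n - (star w ⬝ᵥ momentumNumber (-k) 1 *ᵥ w).re) := ⟨_, rfl⟩
  have hOut_mem : ∀ k ∈ Out, Λ ≤ torusBand L k - μ := fun k hk => (Finset.mem_filter.1 hk).2
  have hIn_mem : ∀ k ∈ In, torusBand L k - μ ≤ -Λ := fun k hk => (Finset.mem_filter.1 hk).2.2
  have hO0 : 0 ≤ O := by
    rw [hO]
    exact Finset.sum_nonneg fun k hk => mul_nonneg (hΛ.le.trans (hOut_mem k hk)) (hα0 k)
  have hI0 : 0 ≤ I := by
    rw [hI]
    exact Finset.sum_nonneg fun k hk => mul_nonneg (by linarith [hIn_mem k hk]) (by linarith [hβn k])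
  -- kinetic budget
  have hkin : (∑ k : TorusSite 2 L, 2 * min (torusBand L k - μ) 0) * n + O + I ≤
      (star w ⬝ᵥ hubbardTorusWith 2 L 1 0 μ *ᵥ w).re := by
    have hdisj : Disjoint Out In := by
      rw [hOut, hIn, Finset.disjoint_filter]
      intro k _ hp hq
      exact hq.1 hp
    have h := sum_budget Out In hdisj (fun k => torusBand L k - μ)
      (fun k => (star w ⬝ᵥ momentumNumber k 0 *ᵥ w).re)
      (fun k => (star w ⬝ᵥ momentumNumber (-k) 1 *ᵥ w).re) n hα0 hαn hβ0 hβn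
      (fun k hk => hΛ.le.trans (hOut_mem k hk)) (fun k hk => by linarith [hIn_mem k hk])
    have hI' : I = ∑ k ∈ In, (-(torusBand L k - μ)) *
        (n - (star w ⬝ᵥ momentumNumber (-k) 1 *ᵥ w).re) := by
      rw [hI]
      exact Finset.sum_congr rfl fun k _ => by ring
    rw [re_expect_hubbardTorusWith_zero hL μ w, hO, hI']
    simpa only [add_assoc] using h
  -- the three regional pair operators
  have hBsplit : B = pairOperator dWaveGap Out + pairOperator dWaveGap In + pairOperator dWaveGap Sh := by
    rw [hB]
    exact pairOperator_univ_eq_add_three dWaveGap _ _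
  -- regional bounds, `Bᴴ` side
  have hg4 : ∀ k : TorusSite 2 L, ∀ x : ℝ, x ≤ n → dWaveGap k ^ 2 * x ≤ 4 * n := by
    intro k x hx
    calc dWaveGap k ^ 2 * x ≤ dWaveGap k ^ 2 * n := mul_le_mul_of_nonneg_left hx (sq_nonneg _)
      _ ≤ 4 * n := mul_le_mul_of_nonneg_right (dWaveGap_sq_le_four k) hn0
  have hOutH : (star ((pairOperator dWaveGap Out)ᴴ *ᵥ w) ⬝ᵥ ((pairOperator dWaveGap Out)ᴴ *ᵥ w)).re ≤
      4 * (L : ℝ) ^ 2 / Λ * O + 4 * (L : ℝ) ^ 2 * n := by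
    rw [re_norm_pairOperator_conjTranspose_mulVec_eq]
    have h1 := re_norm_pairOperator_mulVec_le_out hĝ μ hΛ Out hOut_mem w
    rw [← hO] at h1
    have h2 : ∑ k ∈ Out, dWaveGap k ^ 2 * (n - (star w ⬝ᵥ momentumNumber k 0 *ᵥ w).re -
        (star w ⬝ᵥ momentumNumber (-k) 1 *ᵥ w).re) ≤ 4 * (L : ℝ) ^ 2 * n := by
      calc ∑ k ∈ Out, dWaveGap k ^ 2 * (n - (star w ⬝ᵥ momentumNumber k 0 *ᵥ w).re -
            (star w ⬝ᵥ momentumNumber (-k) 1 *ᵥ w).re) ≤ ∑ _k ∈ Out, 4 * n :=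
            Finset.sum_le_sum fun k _ => hg4 k _ (by linarith [hα0 k, hβ0 k])
        _ = 4 * Out.card * n := by rw [Finset.sum_const, nsmul_eq_mul]; ring
        _ ≤ 4 * (L : ℝ) ^ 2 * n :=
            mul_le_mul_of_nonneg_right (by linarith [hcardL Out]) hn0
    have h3 : 4 * (Out.card : ℝ) / Λ * O ≤ 4 * (L : ℝ) ^ 2 / Λ * O :=
      mul_le_mul_of_nonneg_right
        (div_le_div_of_nonneg_right (by linarith [hcardL Out]) hΛ.le) hO0
    linarith
  have hInH : (star ((pairOperator dWaveGap In)ᴴ *ᵥ w) ⬝ᵥ ((pairOperator dWaveGap In)ᴴ *ᵥ w)).re ≤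
      4 * (L : ℝ) ^ 2 / Λ * I := by
    have h1 := re_norm_pairOperator_conjTranspose_mulVec_le_in hĝ μ hΛ In hIn_mem w
    rw [← hn, ← hI] at h1
    have h3 : 4 * (In.card : ℝ) / Λ * I ≤ 4 * (L : ℝ) ^ 2 / Λ * I :=
      mul_le_mul_of_nonneg_right
        (div_le_div_of_nonneg_right (by linarith [hcardL In]) hΛ.le) hI0
    linarith
  have hShH : (star ((pairOperator dWaveGap Sh)ᴴ *ᵥ w) ⬝ᵥ ((pairOperator dWaveGap Sh)ᴴ *ᵥ w)).re ≤
      4 * (Sh.card : ℝ) ^ 2 * n := re_norm_pairOperator_conjTranspose_mulVec_le_shell hĝ Sh w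
  -- `‖Bᴴ w‖²`
  have hBH : (star (Bᴴ *ᵥ w) ⬝ᵥ (Bᴴ *ᵥ w)).re ≤
      3 * (4 * (L : ℝ) ^ 2 / Λ * O + 4 * (L : ℝ) ^ 2 * n + 4 * (L : ℝ) ^ 2 / Λ * I +
        4 * (Sh.card : ℝ) ^ 2 * n) := by
    have h := re_star_dotProduct_add_three_self_le ((pairOperator dWaveGap Out)ᴴ *ᵥ w)
      ((pairOperator dWaveGap In)ᴴ *ᵥ w) ((pairOperator dWaveGap Sh)ᴴ *ᵥ w)
    rw [← add_mulVec, ← add_mulVec, ← conjTranspose_add, ← conjTranspose_add, ← hBsplit] at h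
    linarith [h, hOutH, hInH, hShH]
  -- the pairing term
  obtain ⟨hDD, -⟩ := pairField_scaled_mul_conjTranspose (L := L)
  rw [← hB] at hDD
  have hpair : (star w ⬝ᵥ ((J : ℂ) • ((((L : ℂ))⁻¹ • pairField dWaveFormFactor L) *
      (((L : ℂ))⁻¹ • pairField dWaveFormFactor L)ᴴ)) *ᵥ w).re =
      J * (8 / (L : ℝ) ^ 2) * (star (Bᴴ *ᵥ w) ⬝ᵥ (Bᴴ *ᵥ w)).re := by
    rw [hDD, smul_mulVec, dotProduct_smul, smul_eq_mul, Complex.re_ofReal_mul, smul_mulVec,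
      dotProduct_smul, smul_eq_mul, Complex.re_ofReal_mul, star_mulVec, ← dotProduct_mulVec,
      mulVec_mulVec, conjTranspose_conjTranspose, mul_assoc]
  -- assemble
  rw [sub_mulVec, dotProduct_sub, Complex.sub_re, hpair]
  have hJL : 0 ≤ J * (8 / (L : ℝ) ^ 2) := by positivity
  have h1 : J * (8 / (L : ℝ) ^ 2) * (star (Bᴴ *ᵥ w) ⬝ᵥ (Bᴴ *ᵥ w)).re ≤
      J * (8 / (L : ℝ) ^ 2) * (3 * (4 * (L : ℝ) ^ 2 / Λ * O + 4 * (L : ℝ) ^ 2 * n +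
        4 * (L : ℝ) ^ 2 / Λ * I + 4 * (Sh.card : ℝ) ^ 2 * n)) :=
    mul_le_mul_of_nonneg_left hBH hJL
  have h2 : J * (8 / (L : ℝ) ^ 2) * (3 * (4 * (L : ℝ) ^ 2 / Λ * O + 4 * (L : ℝ) ^ 2 * n +
      4 * (L : ℝ) ^ 2 / Λ * I + 4 * (Sh.card : ℝ) ^ 2 * n)) =
      96 * (J / Λ) * (O + I) + 96 * J * n + 96 * J * c₂ * n := by
    rw [hc₂]
    field_simp
    ring
  have h3 : 96 * (J / Λ) * (O + I) ≤ O + I := by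
    have hJΛ' : J / Λ ≤ 1 / 96 := by
      rw [div_le_div_iff₀ hΛ (by norm_num : (0 : ℝ) < 96)]
      linarith
    have hOI : 0 ≤ O + I := add_nonneg hO0 hI0
    calc 96 * (J / Λ) * (O + I) ≤ 96 * (1 / 96) * (O + I) :=
          mul_le_mul_of_nonneg_right (by linarith) hOI
      _ = O + I := by ring
  have hc₂' : 96 * J * ((Sh.card : ℝ) ^ 2 / (L : ℝ) ^ 2) = 96 * J * c₂ := by rw [hc₂]
  have hgoal : (∑ k : TorusSite 2 L, 2 * min (torusBand L k - μ) 0 -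
      (96 * J + 96 * J * ((Sh.card : ℝ) ^ 2 / (L : ℝ) ^ 2))) * n =
      (∑ k : TorusSite 2 L, 2 * min (torusBand L k - μ) 0) * n - 96 * J * n - 96 * J * c₂ * n := by
    rw [hc₂']
    ring
  rw [hgoal]
  linarith [hkin, h1, h2, h3]


/-- **The free layer does not gain from the reduced BCS interaction, `Bᴴ B` ordering**: under
the hypotheses of `re_expect_free_sub_pairing_ge`,
`Re ⟨w, (H(1,0) - μN - J Dᴴ D) w⟩ ≥ (Σ_k 2min(ξ_k,0) - 128J - 96J s²/L²) ‖w‖²` — from the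
`D Dᴴ` ordering and the commutator sum `B Bᴴ - Bᴴ B = Σ_k ĝ(k)²(1 - n_{k↑} - n_{-k↓}) ≥ -4L²`
(as forms, per unit norm). [folklore] -/
theorem re_expect_free_sub_pairing_ge' (hL : 3 ≤ L) (μ : ℝ) {Λ J : ℝ} (hΛ : 0 < Λ) (hJ : 0 ≤ J)
    (hJΛ : 96 * J ≤ Λ) (w : Fock (Orb (FermionTorus 2 L))) :
    (∑ k : TorusSite 2 L, 2 * min (torusBand L k - μ) 0 - (128 * J + 96 * J *
      (((univ.filter fun k : TorusSite 2 L => ¬ (Λ ≤ torusBand L k - μ) ∧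
        ¬ (torusBand L k - μ ≤ -Λ)).card : ℝ) ^ 2 / (L : ℝ) ^ 2))) * (star w ⬝ᵥ w).re ≤
      (star w ⬝ᵥ (hubbardTorusWith 2 L 1 0 μ -
        (J : ℂ) • ((((L : ℂ))⁻¹ • pairField dWaveFormFactor L)ᴴ *
          (((L : ℂ))⁻¹ • pairField dWaveFormFactor L))) *ᵥ w).re := by
  have h := re_expect_free_sub_pairing_ge hL μ hΛ hJ hJΛ w
  obtain ⟨B, hB⟩ : ∃ B, B = pairOperator dWaveGap (univ : Finset (TorusSite 2 L)) := ⟨_, rfl⟩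
  obtain ⟨hDD, hDD'⟩ := pairField_scaled_mul_conjTranspose (L := L)
  rw [← hB] at hDD hDD'
  set n : ℝ := (star w ⬝ᵥ w).re with hn
  have hn0 : 0 ≤ n := re_star_dotProduct_self_nonneg' w
  have hL0 : (0 : ℝ) < L := by exact_mod_cast (show 0 < L by omega)
  -- the two pairing terms as norms
  have h1 : (star w ⬝ᵥ ((J : ℂ) • ((((L : ℂ))⁻¹ • pairField dWaveFormFactor L) *
      (((L : ℂ))⁻¹ • pairField dWaveFormFactor L)ᴴ)) *ᵥ w).re =
      J * (8 / (L : ℝ) ^ 2) * (star (Bᴴ *ᵥ w) ⬝ᵥ (Bᴴ *ᵥ w)).re := by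
    rw [hDD, smul_mulVec, dotProduct_smul, smul_eq_mul, Complex.re_ofReal_mul, smul_mulVec,
      dotProduct_smul, smul_eq_mul, Complex.re_ofReal_mul, star_mulVec, ← dotProduct_mulVec,
      mulVec_mulVec, conjTranspose_conjTranspose, mul_assoc]
  have h2 : (star w ⬝ᵥ ((J : ℂ) • ((((L : ℂ))⁻¹ • pairField dWaveFormFactor L)ᴴ *
      (((L : ℂ))⁻¹ • pairField dWaveFormFactor L))) *ᵥ w).re =
      J * (8 / (L : ℝ) ^ 2) * (star (B *ᵥ w) ⬝ᵥ (B *ᵥ w)).re := by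
    rw [hDD', smul_mulVec, dotProduct_smul, smul_eq_mul, Complex.re_ofReal_mul, smul_mulVec,
      dotProduct_smul, smul_eq_mul, Complex.re_ofReal_mul, star_mulVec, ← dotProduct_mulVec,
      mulVec_mulVec, mul_assoc]
  -- the commutator sum is at least `-4L² ‖w‖²`
  have h3 := re_norm_pairOperator_conjTranspose_mulVec_eq dWaveGap (univ : Finset (TorusSite 2 L)) w
  rw [← hB] at h3
  have h4 : -(4 * (L : ℝ) ^ 2 * n) ≤ ∑ k : TorusSite 2 L, dWaveGap k ^ 2 *
      ((star w ⬝ᵥ w).re - (star w ⬝ᵥ momentumNumber k 0 *ᵥ w).re -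
        (star w ⬝ᵥ momentumNumber (-k) 1 *ᵥ w).re) := by
    have hle : ∀ k : TorusSite 2 L, -(4 * n) ≤ dWaveGap k ^ 2 *
        ((star w ⬝ᵥ w).re - (star w ⬝ᵥ momentumNumber k 0 *ᵥ w).re -
          (star w ⬝ᵥ momentumNumber (-k) 1 *ᵥ w).re) := by
      intro k
      have hx : (star w ⬝ᵥ momentumNumber k 0 *ᵥ w).re +
          (star w ⬝ᵥ momentumNumber (-k) 1 *ᵥ w).re - n ≤ n := by
        linarith [re_expect_momentumNumber_le k 0 w, re_expect_momentumNumber_le (-k) 1 w]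
      have hg : dWaveGap k ^ 2 * ((star w ⬝ᵥ momentumNumber k 0 *ᵥ w).re +
          (star w ⬝ᵥ momentumNumber (-k) 1 *ᵥ w).re - n) ≤ 4 * n :=
        calc dWaveGap k ^ 2 * ((star w ⬝ᵥ momentumNumber k 0 *ᵥ w).re +
              (star w ⬝ᵥ momentumNumber (-k) 1 *ᵥ w).re - n)
            ≤ dWaveGap k ^ 2 * n := mul_le_mul_of_nonneg_left hx (sq_nonneg _)
          _ ≤ 4 * n := mul_le_mul_of_nonneg_right (dWaveGap_sq_le_four k) hn0
      rw [← hn]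
      linarith
    calc -(4 * (L : ℝ) ^ 2 * n) = ∑ _k : TorusSite 2 L, -(4 * n) := by
          rw [Finset.sum_const, Finset.card_univ, card_torusSite_two, nsmul_eq_mul]
          push_cast
          ring
      _ ≤ _ := Finset.sum_le_sum fun k _ => hle k
  have hJL : 0 ≤ J * (8 / (L : ℝ) ^ 2) := by positivity
  have h5 : J * (8 / (L : ℝ) ^ 2) * (star (B *ᵥ w) ⬝ᵥ (B *ᵥ w)).re ≤
      J * (8 / (L : ℝ) ^ 2) * (star (Bᴴ *ᵥ w) ⬝ᵥ (Bᴴ *ᵥ w)).re + 32 * J * n := by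
    have h6 : J * (8 / (L : ℝ) ^ 2) * (star (B *ᵥ w) ⬝ᵥ (B *ᵥ w)).re ≤
        J * (8 / (L : ℝ) ^ 2) * ((star (Bᴴ *ᵥ w) ⬝ᵥ (Bᴴ *ᵥ w)).re + 4 * (L : ℝ) ^ 2 * n) :=
      mul_le_mul_of_nonneg_left (by linarith) hJL
    have h7 : J * (8 / (L : ℝ) ^ 2) * (4 * (L : ℝ) ^ 2 * n) = 32 * J * n := by
      field_simp
      ring
    linarith
  rw [sub_mulVec, dotProduct_sub, Complex.sub_re, h1] at h
  rw [sub_mulVec, dotProduct_sub, Complex.sub_re, h2]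
  have hgoal : ∀ c : ℝ, (∑ k : TorusSite 2 L, 2 * min (torusBand L k - μ) 0 - (c * J + 96 * J *
      (((univ.filter fun k : TorusSite 2 L => ¬ (Λ ≤ torusBand L k - μ) ∧
        ¬ (torusBand L k - μ ≤ -Λ)).card : ℝ) ^ 2 / (L : ℝ) ^ 2))) * n =
      (∑ k : TorusSite 2 L, 2 * min (torusBand L k - μ) 0 - (96 * J +
        96 * J * (((univ.filter fun k : TorusSite 2 L => ¬ (Λ ≤ torusBand L k - μ) ∧
          ¬ (torusBand L k - μ ≤ -Λ)).card : ℝ) ^ 2 / (L : ℝ) ^ 2))) * n - (c - 96) * J * n := by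
    intro c
    ring
  rw [hgoal 128]
  linarith

end GCBound

end Summit.HubbardSuperconductivity.HubbardSuperconductivity.Theorems.JosephsonMirror
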